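import Summits.BirchSwinnertonDyer.Rank1Residual.X11b.WeakLeopoldt
import Literature.NumberTheory.GaloisRepresentations.ContinuousH1ResCocycle
import Literature.NumberTheory.EllipticCurves.SubgroupSelmerProofs
import Literature.NumberTheory.EllipticCurves.SubgroupSelmerCocycleCriteriaProofs
import HarnessLib

/-!
# `Ш²(K, E[p^∞])` is FINITE, of order `≤ #Sel_{p^∞}(E/K)`, when `Sel_{p^∞}(E/K)` is finite and `E(K)[p] = 0` —
# from Poitou–Tate duality of `Ш` at ONE finite level at a time (K4 Prop-4.12 elimination lane, part 4a)

Route `ThetaPartnerAtTwo` (TP2; crux shared with `ResidualThetaTransportAtTwo`), crux K4 `SignedControlAtTwo`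
(stmt-BirchSwinnertonDyer-20309), line `eulerchar` v10. Seat `prover-bsd-wall-tp2-p3-w2` (width seat 2/3, gen 5).

Parts 2–3 reduced K4 (COINV⁺@2, EC2, both conjuncts for every curve of the row) to CASSELS and the vanishing of the second
Tate–Shafarevich group `Ш²(ℚ, E[2^∞]) = ⋂_{all v} ker(H²(ℚ, E[2^∞]) → H²(ℚ_v, E[2^∞]))`. This file, for an ARBITRARY
number field `K` and prime `p`: **`Ш²(K, E[p^∞])` is finite of order at most `#Sel_{p^∞}(E/K)`** when `Sel_{p^∞}(E/K)` is
finite and `E[p^∞]^{Γ_K} = 0`, GRANTED the cited Poitou–Tate duality of `Ш` at finite level (`poitouTate_sha_tateDual K`,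
Harari Thm. 17.13 (b) = Milne I Thm. 4.10 (a)). The sub-cell X11b (route R1, `WeakLeopoldt.lean`) proved the same for ALL
of `H²(K, E[p^∞])` over a TOTALLY COMPLEX `K` (where the local `H²` vanish everywhere); here `K` may have real places,
the price being the restriction to `Ш²` (classes locally trivial at the real places too):

* §1 `coe_mem_selmerGroupPInfty_of_mem_sha` — `Ш¹(K, E[p^∞]) ⊆ Sel_{p^∞}(E/K)` (a class trivial in `H¹(K_v, E[p^∞])`
  is trivial in `H¹(K_v, E)`), for the tree's classical Selmer group `WeierstrassCurve.selmerGroupPInfty`;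
  `natCard_sha_torsion_le_selmerGroupPInfty`, **`natCard_shaTwo_torsion_le_selmerGroupPInfty`**:
  `#Ш²(K, E[p^k]) = #Ш¹(K, E[p^k]^D) ≤ #Ш¹(K, E[p^k]) ≤ #Sel_{p^∞}(E/K)` uniformly in `k ≥ 1` (PT fact; Weil pairing at
  the single level `p^k`, `ShaBound.natCard_sha_tateDual_le`; `H¹(K, E[p^k]) ↪ H¹(K, E[p^∞])` when `E[p^∞]^{Γ_K} = 0`).
* §2 `exists_le_map_torsionInclusion_two_eq_zero` — **a class of `H²(E, E[p^N])` that dies in `H²(E, E[p^∞])` dies in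
  some `H²(E, E[p^M])`** (any `K`-field `E`: the bounding `1`-cochain has finite range in the discrete `E[p^∞]`);
  monotonicity in `M`.
* §3 `exists_mem_shaTwo_map_primaryInclusion_eq` — every class of `Ш²(K, E[p^∞])` is the image of a class of
  `Ш²(K, E[p^M])` for some `M` (finite support of global `H²`-classes, X11b `H2Support`, + §2 at the finitely many
  exceptional finite places and at the infinite places); **`finite_shaTwo_primary`, `natCard_shaTwo_primary_le`**.
HONEST FRAMING: THEOREMS ONLY (no definition, no named fact, no `sorry`); CONDITIONAL on the cited fact
`poitouTate_sha_tateDual K` (hypothesis, by name); credit X11b (b2b-bsdres-multr1-p1) for `ShaTwoLevelBound`,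
`GlobalH2FiniteSupport`, `PrimaryInclusionLevels`; closes no item by itself; BSD is not proved by any of this.

References: [Harari2020] Thm. 17.13 (b), Lemma 17.8; [MilneADT2006] I Thm. 4.10 (a), Lemma 4.8, I §6;
[JetchevSkinnerWan2017] Lemma 3.3.3 (arXiv:1512.06894 p. 12); [GreenbergLNM1716] §2 p. 63, §3 Lemma 3.3;
[SilvermanAEC2009] Prop. III.8.1, X.4.2.
-/

set_option autoImplicit false
-- the Theorems namespace of this sub repeats the summit name by design (D-0017 nested layout)
set_option linter.dupNamespace false

noncomputable section

open scoped Classical NumberField ContRepresentation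

open CategoryTheory NumberField IsDedekindDomain Field Function WeierstrassCurve
open Literature.NumberTheory.EllipticCurves Literature.NumberTheory.GaloisRepresentations
open Literature.NumberTheory.GaloisRepresentations.DiscreteGaloisModule (sha shaTwo mem_sha_iff mem_shaTwo_iff tateDual)
open Literature.NumberTheory.GaloisCohomology
open Summit.BirchSwinnertonDyer.Rank1Residual.X11b (LocBridge.primaryGaloisModule)
open Summit.BirchSwinnertonDyer.Rank1Residual.X11b.Levels (primaryInclusion)

namespace Summit.BirchSwinnertonDyer.BirchSwinnertonDyer.Theorems.SignedEC.ShaTwo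

/-! ## §1 `Ш¹(K, E[p^∞]) ⊆ Sel_{p^∞}(E/K)`; the uniform bound `#Ш²(K, E[p^k]) ≤ #Sel_{p^∞}(E/K)` -/

section Bound

variable {K : Type} [Field K] [NumberField K] (W : WeierstrassCurve K) (p : ℕ)

omit [NumberField K] in
/-- A class of `H¹(K, E[p^∞])` that is locally trivial in `H¹(K_E, E[p^∞])` (restriction along `Γ_E → Γ_K`) dies in
`H¹(Γ_E, E(K̄_E))`, i.e. lies in the local Selmer kernel `selmerLocalKerPrimary W E p` (the local Kummer condition is
weaker than local triviality). [cite: GreenbergLNM1716, §2 p. 63] [cite: SilvermanAEC2009, X.4.2] -/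
theorem mem_selmerLocalKerPrimary_of_res_eq_zero (E : Type) [Field E] [Algebra K E]
    (c : galoisCohomology (LocBridge.primaryGaloisModule W p) 1)
    (hc : galoisCohomology.res (LocBridge.primaryGaloisModule W p) E 1 c = 0) :
    (c : W.galH1Primary p) ∈ selmerLocalKerPrimary W E p := by
  obtain ⟨φ, rfl⟩ := oneCocycleClass_surjective _ c
  rw [galoisCohomology.res_oneCocycleClass] at hc
  obtain ⟨m, hm⟩ := (oneCocycleClass_eq_zero_iff _ _).mp hc
  change oneCocycleClass (discreteTopRep (absoluteGaloisGroup K) (W.geomPrimaryTorsion p)) φ ∈ _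
  rw [W.mem_selmerLocalKerPrimary_iff p, CocycleCriteria.resH1Hom_oneCocycleClass_eq_zero_iff]
  refine ⟨((pointsMap W E).comp (W.geomPrimaryTorsion p).subtype) m, fun σ ↦ ?_⟩
  have h := hm σ
  rw [galoisCohomology.pullback_absGaloisRestrict_apply] at h
  change φ.1 (resGal (K := K) E σ) = resGal (K := K) E σ • m - m at h
  rw [h, map_sub, W.pointsMap_comp_subtype_smul p]

/-- **`Ш¹(K, E[p^∞]) ⊆ Sel_{p^∞}(E/K)`**: a class of `H¹(K, E[p^∞])` locally trivial at EVERY place lies in the classical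
`p^∞`-Selmer group (`WeierstrassCurve.selmerGroupPInfty`, kernels of `H¹(K, E[p^∞]) → H¹(K_v, E)` at all places).
[cite: GreenbergLNM1716, §2 p. 63] [cite: MilneADT2006, Ch. I §6] -/
theorem coe_mem_selmerGroupPInfty_of_mem_sha (c : galoisCohomology (LocBridge.primaryGaloisModule W p) 1)
    (hc : c ∈ sha (LocBridge.primaryGaloisModule W p)) : (c : W.galH1Primary p) ∈ W.selmerGroupPInfty p := by
  rw [DiscreteGaloisModule.mem_sha_iff] at hc
  refine AddSubgroup.mem_inf.mpr ⟨AddSubgroup.mem_iInf.mpr fun v ↦ ?_, AddSubgroup.mem_iInf.mpr fun w ↦ ?_⟩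
  · exact mem_selmerLocalKerPrimary_of_res_eq_zero W p (v.adicCompletion K) c (hc (Sum.inr v))
  · exact mem_selmerLocalKerPrimary_of_res_eq_zero W p w.Completion c (hc (Sum.inl w))

/-- **`#Ш¹(K, E[p^k]) ≤ #Sel_{p^∞}(E/K)`** when `Sel_{p^∞}(E/K)` is finite and `E[p^∞]^{Γ_K} = 0`:
`H¹(ι_k) : H¹(K, E[p^k]) → H¹(K, E[p^∞])` is injective (`Levels.map_primaryInclusion_injective`) and carries `Ш¹` into
`Ш¹ ⊆ Sel_{p^∞}` (`ShaBound.map_mem_sha`, §1). [cite: GreenbergLNM1716, §2 p. 63] [cite: JetchevSkinnerWan2017, Lemma 3.3.3 (arXiv:1512.06894 p. 12)] -/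
theorem natCard_sha_torsion_le_selmerGroupPInfty (k : ℕ) [Finite (W.selmerGroupPInfty p)]
    (hΓ : ∀ Q : W.geomPrimaryTorsion p, (∀ σ : absoluteGaloisGroup K, LocBridge.primaryGaloisModule W p σ Q = Q) → Q = 0) :
    Finite (sha (W.torsionGaloisModule ((p ^ k : ℕ) : ℤ))) ∧
      Nat.card (sha (W.torsionGaloisModule ((p ^ k : ℕ) : ℤ))) ≤ Nat.card (W.selmerGroupPInfty p) := by
  let f : sha (W.torsionGaloisModule ((p ^ k : ℕ) : ℤ)) → W.selmerGroupPInfty p := fun x ↦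
    ⟨(galoisCohomology.map (primaryInclusion W p k) 1 (x : _) : W.galH1Primary p),
      coe_mem_selmerGroupPInfty_of_mem_sha W p _
        (Summit.BirchSwinnertonDyer.Rank1Residual.X11b.ShaBound.map_mem_sha _ x.2)⟩
  have hf : Function.Injective f := fun x₁ x₂ h ↦ Subtype.ext
    (Summit.BirchSwinnertonDyer.Rank1Residual.X11b.Levels.map_primaryInclusion_injective W p k hΓ
      (congrArg Subtype.val h))
  exact ⟨Finite.of_injective f hf, Nat.card_le_card_of_injective f hf⟩

/-- **`#Ш²(K, E[p^k]) ≤ #Sel_{p^∞}(E/K)` for every `k ≥ 1`**, granted the cited Poitou–Tate duality of `Ш` at the level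
`p^k` (`poitouTate_sha_tateDual K`, Harari Thm. 17.13 (b)): `#Ш²(K, E[p^k]) = #Ш¹(K, E[p^k]^D) ≤ #Ш¹(K, E[p^k])`
(Weil pairing at ONE level, `ShaBound.natCard_sha_tateDual_le`) `≤ #Sel_{p^∞}(E/K)`.
[cite: Harari2020, Thm. 17.13 (b)] [cite: MilneADT2006, Ch. I, Thm. 4.10 (a)] [cite: SilvermanAEC2009, Prop. III.8.1] -/
theorem natCard_shaTwo_torsion_le_selmerGroupPInfty [Fact p.Prime] [W.IsElliptic] (hPT : poitouTate_sha_tateDual K) {k : ℕ} (hk : k ≠ 0)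
    [Finite (W.selmerGroupPInfty p)]
    (hΓ : ∀ Q : W.geomPrimaryTorsion p, (∀ σ : absoluteGaloisGroup K, LocBridge.primaryGaloisModule W p σ Q = Q) → Q = 0) :
    Finite (shaTwo (W.torsionGaloisModule ((p ^ k : ℕ) : ℤ))) ∧
      Nat.card (shaTwo (W.torsionGaloisModule ((p ^ k : ℕ) : ℤ))) ≤ Nat.card (W.selmerGroupPInfty p) := by
  have hprime : p.Prime := Fact.out
  haveI : NeZero (p ^ k) := ⟨pow_ne_zero k hprime.ne_zero⟩
  haveI : Finite (W.geomTorsion ((p ^ k : ℕ) : ℤ)) := finite_geomTorsion_of_neZero W (p ^ k)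
  have h2 : 2 ≤ p ^ k :=
    le_trans hprime.two_le (by simpa using Nat.pow_le_pow_right hprime.pos (Nat.one_le_iff_ne_zero.2 hk))
  obtain ⟨hfin2, -, hcard⟩ := Summit.BirchSwinnertonDyer.Rank1Residual.X11b.ShaBound.natCard_shaTwo_eq_natCard_sha_tateDual
    hPT (p ^ k) (W.torsionGaloisModule ((p ^ k : ℕ) : ℤ)) (fun T ↦ AddSubgroup.torsionBy.nsmul T)
  obtain ⟨hfin1, hle⟩ := natCard_sha_torsion_le_selmerGroupPInfty W p k hΓ
  haveI := hfin1
  exact ⟨hfin2, hcard ▸ (Summit.BirchSwinnertonDyer.Rank1Residual.X11b.ShaBound.natCard_sha_tateDual_le W (p ^ k) h2).trans hle⟩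

end Bound

/-! ## §2 A finite-level class that dies in `H²(E, E[p^∞])` dies at some finite level -/

section Limit

variable {K : Type} [Field K] (W : WeierstrassCurve K) (p : ℕ) (E : Type) [Field E] [Algebra K E]

/-- Cocycle-level core of `exists_le_map_torsionInclusion_two_eq_zero`: if `ι_N ∘ c = ∂b` with `p^M b = 0`
pointwise (`N ≤ M`), then the image of `[c]` in `H²(E, E[p^M])` vanishes (lift `b` through `E[p^M] ↪ E[p^∞]`).
[cite: SerreGaloisCohomology1997, I §2.2 Prop. 8] -/
theorem map_torsionInclusion_twoCocycleClass_eq_zero_of_bound [CompactSpace (absoluteGaloisGroup E)] {N M : ℕ}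
    (c : contTwoCocycles (GaloisRep.restrictField E (W.torsionGaloisModule ((p ^ N : ℕ) : ℤ))).toTopRep)
    (b : C(absoluteGaloisGroup E, W.geomPrimaryTorsion p))
    (hb : ∀ σ τ : absoluteGaloisGroup E,
      (contTwoCocycles.pullback (ContinuousMonoidHom.id _)
        (resIdHom (DiscreteGaloisModule.homOfIntertwining ((primaryInclusion W p N).restrictField E))) c).1 (σ, τ) =
      (GaloisRep.restrictField E (LocBridge.primaryGaloisModule W p)).toTopRep.ρ σ (b τ) - b (σ * τ) + b σ)
    (hNM : N ≤ M) (hM : ∀ σ, p ^ M • b σ = 0) :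
    galoisCohomology.map ((W.torsionInclusion
      (Summit.BirchSwinnertonDyer.Rank1Residual.X11b.WeakLeopoldt.pow_dvd_pow_cast p hNM)).restrictField E) 2
        (twoCocycleClass _ c) = 0 := by
  have hrange := Summit.BirchSwinnertonDyer.Rank1Residual.X11b.Levels.exists_primaryInclusion_restrictField_eq_of_nsmul_eq_zero W p M E
  -- the lift of `b` to `E[p^M]`
  let b' : C(absoluteGaloisGroup E, W.geomTorsion ((p ^ M : ℕ) : ℤ)) :=
    ⟨fun σ ↦ Summit.BirchSwinnertonDyer.Rank1Residual.X11b.Levels.liftTorsion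
        ((primaryInclusion W p M).restrictField E) (p ^ M) hrange (b σ),
      (continuous_of_discreteTopology
        (f := Summit.BirchSwinnertonDyer.Rank1Residual.X11b.Levels.liftTorsion
          ((primaryInclusion W p M).restrictField E) (p ^ M) hrange)).comp b.continuous⟩
  have hb' : ∀ σ, (primaryInclusion W p M).restrictField E (b' σ) = b σ := fun σ ↦
    Summit.BirchSwinnertonDyer.Rank1Residual.X11b.Levels.apply_liftTorsion (hM σ)
  rw [← DiscreteGaloisModule.cohomologyMap_homOfIntertwining, cohomologyMap_twoCocycleClass]
  refine (twoCocycleClass_eq_zero_iff _ _).mpr ⟨b', fun σ τ ↦ ?_⟩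
  apply Summit.BirchSwinnertonDyer.Rank1Residual.X11b.Levels.primaryInclusion_restrictField_injective W p M E
  have key := hb σ τ
  rw [contTwoCocycles.pullback_apply, resIdHom_hom_apply] at key ⊢
  -- the values of `c` pushed to `E[p^∞]` through either level agree
  have lhs : (primaryInclusion W p M).restrictField E
      ((DiscreteGaloisModule.homOfIntertwining ((W.torsionInclusion
        (Summit.BirchSwinnertonDyer.Rank1Residual.X11b.WeakLeopoldt.pow_dvd_pow_cast p hNM)).restrictField E)).hom
        (c.1 (ContinuousMonoidHom.id _ σ, ContinuousMonoidHom.id _ τ))) =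
      (DiscreteGaloisModule.homOfIntertwining ((primaryInclusion W p N).restrictField E)).hom
        (c.1 (ContinuousMonoidHom.id _ σ, ContinuousMonoidHom.id _ τ)) := Subtype.ext rfl
  rw [map_add, map_sub, lhs, key, hb', hb', ← hb' τ]
  exact congrArg (fun x ↦ x - b (σ * τ) + b σ)
    (((primaryInclusion W p M).restrictField E).isIntertwining σ (b' τ)).symm

/-- **"Dies in the limit ⟹ dies at a finite level"**: if the image of a class `z ∈ H²(E, E[p^N])` in `H²(E, E[p^∞])`
vanishes (any `K`-field `E`, e.g. a completion), then its image in `H²(E, E[p^M])` vanishes for some `M ≥ N`: the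
bounding continuous `1`-cochain `b : Γ_E → E[p^∞]` has finite range (compact `Γ_E`, discrete `E[p^∞]`), hence takes
values in some `E[p^M]`, through which it lifts (`H²(E, lim→ E[p^k]) = lim→ H²(E, E[p^k])`, injectivity half, for the
modules at hand). [cite: SerreGaloisCohomology1997, I §2.2 Prop. 8] -/
theorem exists_le_map_torsionInclusion_two_eq_zero {N : ℕ}
    (z : galoisCohomology (GaloisRep.restrictField E (W.torsionGaloisModule ((p ^ N : ℕ) : ℤ))) 2)
    (hz : galoisCohomology.map ((primaryInclusion W p N).restrictField E) 2 z = 0) :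
    ∃ (M : ℕ) (h : N ≤ M), galoisCohomology.map
      ((W.torsionInclusion (Summit.BirchSwinnertonDyer.Rank1Residual.X11b.WeakLeopoldt.pow_dvd_pow_cast p h)).restrictField E)
        2 z = 0 := by
  haveI : CompactSpace (absoluteGaloisGroup E) := absoluteGaloisGroup_compactSpace E
  obtain ⟨c, rfl⟩ := twoCocycleClass_surjective _ z
  rw [← DiscreteGaloisModule.cohomologyMap_homOfIntertwining, cohomologyMap_twoCocycleClass] at hz
  obtain ⟨b, hb⟩ := (twoCocycleClass_eq_zero_iff _ _).mp hz
  -- a common killing exponent for the (finitely many) values of `b`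
  have hB : ∀ Q : W.geomPrimaryTorsion p, ∃ k : ℕ, p ^ k • Q = 0 := fun Q ↦
    (AddCommGroup.mem_primaryComponent.mp Q.2).imp fun k hk ↦
      Subtype.ext (by rw [AddSubmonoidClass.coe_nsmul, hk, ZeroMemClass.coe_zero])
  obtain ⟨M₀, hM₀⟩ := exists_pow_smul_apply_eq_zero b fun σ ↦ hB (b σ)
  have hM : ∀ σ, p ^ (N + M₀) • b σ = 0 := fun σ ↦ by
    rw [pow_add, mul_smul, hM₀, smul_zero]
  exact ⟨N + M₀, Nat.le_add_right N M₀, map_torsionInclusion_twoCocycleClass_eq_zero_of_bound W p E c b hb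
    (Nat.le_add_right N M₀) hM⟩

/-- **Monotonicity**: if the image of `z ∈ H²(E, E[p^N])` vanishes in `H²(E, E[p^M])` then it vanishes in
`H²(E, E[p^{M'}])` for every `M' ≥ M` (functoriality of the transition maps). [folklore] -/
theorem map_torsionInclusion_two_eq_zero_mono {N M M' : ℕ} (hNM : N ≤ M) (hMM' : M ≤ M')
    (z : galoisCohomology (GaloisRep.restrictField E (W.torsionGaloisModule ((p ^ N : ℕ) : ℤ))) 2)
    (hz : galoisCohomology.map ((W.torsionInclusion
      (Summit.BirchSwinnertonDyer.Rank1Residual.X11b.WeakLeopoldt.pow_dvd_pow_cast p hNM)).restrictField E) 2 z = 0) :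
    galoisCohomology.map ((W.torsionInclusion
      (Summit.BirchSwinnertonDyer.Rank1Residual.X11b.WeakLeopoldt.pow_dvd_pow_cast p (hNM.trans hMM'))).restrictField E)
        2 z = 0 := by
  rw [← Summit.BirchSwinnertonDyer.Rank1Residual.X11b.Levels.map_two_map_two_eq_map_two
    (ρ₁ := GaloisRep.restrictField E (W.torsionGaloisModule ((p ^ N : ℕ) : ℤ)))
    (ρ₂ := GaloisRep.restrictField E (W.torsionGaloisModule ((p ^ M : ℕ) : ℤ)))
    (ρ₃ := GaloisRep.restrictField E (W.torsionGaloisModule ((p ^ M' : ℕ) : ℤ)))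
    ((W.torsionInclusion (Summit.BirchSwinnertonDyer.Rank1Residual.X11b.WeakLeopoldt.pow_dvd_pow_cast p hNM)).restrictField E)
    ((W.torsionInclusion (Summit.BirchSwinnertonDyer.Rank1Residual.X11b.WeakLeopoldt.pow_dvd_pow_cast p hMM')).restrictField E)
    _ (fun Q ↦ Subtype.ext rfl) z, hz, map_zero]

end Limit

/-! ## §3 Every class of `Ш²(K, E[p^∞])` comes from some `Ш²(K, E[p^M])`; finiteness and the bound -/

section Global

variable {K : Type} [Field K] [NumberField K]

/-- **Naturality of localisation in degree `2` at an INFINITE place** (`loc_w ∘ H²(f) = H²(f|_{Γ_{K_w}}) ∘ loc_w`; the finite-place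
twin is X11b's `WeakLeopoldt.localization_inr_map_two`). [folklore] -/
theorem localization_inl_map_two {M M' : Type} [AddCommGroup M] [TopologicalSpace M] [DiscreteTopology M]
    [AddCommGroup M'] [TopologicalSpace M'] [DiscreteTopology M']
    {ρ : DiscreteGaloisModule K M} {ρ' : DiscreteGaloisModule K M'}
    (f : ρ.toContRepresentation →ⁱL ρ'.toContRepresentation) (w : InfinitePlace K) (x : galoisCohomology ρ 2) :
    galoisCohomology.localization ρ' (Sum.inl w) 2 (galoisCohomology.map f 2 x) =
      galoisCohomology.map (f.restrictField w.Completion) 2 (galoisCohomology.localization ρ (Sum.inl w) 2 x) := by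
  haveI : CompactSpace (absoluteGaloisGroup K) := absoluteGaloisGroup_compactSpace K
  haveI : CompactSpace (absoluteGaloisGroup (Place.Completion (Sum.inl w : Place K))) := absoluteGaloisGroup_compactSpace _
  haveI : CompactSpace (absoluteGaloisGroup w.Completion) := absoluteGaloisGroup_compactSpace _
  obtain ⟨c, rfl⟩ := twoCocycleClass_surjective _ x
  -- localisation on `2`-cocycles at `w`: `loc_w [c] = [c ∘ (res_w × res_w)]`, for `ρ` and `ρ'`
  have loc : ∀ {N : Type} [AddCommGroup N] [TopologicalSpace N] [DiscreteTopology N] (τ : DiscreteGaloisModule K N)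
      (d : contTwoCocycles τ.toTopRep),
      galoisCohomology.localization τ (Sum.inl w) 2 (twoCocycleClass τ.toTopRep d) =
        twoCocycleClass (DiscreteGaloisModule.toTopRep (τ.toLocal (Sum.inl w)))
          (contTwoCocycles.pullback (absGaloisRestrict K w.Completion) (X := τ.toTopRep)
            (Y := DiscreteGaloisModule.toTopRep (τ.toLocal (Sum.inl w)))
            (TopRep.ofHom ⟨ContinuousLinearMap.id ℤ N, fun _ => rfl⟩) d) :=
    fun τ d ↦ map_twoCocycleClass _ _ _ d
  rw [← DiscreteGaloisModule.cohomologyMap_homOfIntertwining, cohomologyMap_twoCocycleClass, loc, loc,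
    ← DiscreteGaloisModule.cohomologyMap_homOfIntertwining]
  refine Eq.trans ?_ (cohomologyMap_twoCocycleClass
    (DiscreteGaloisModule.homOfIntertwining (f.restrictField w.Completion)) _).symm
  exact congrArg (twoCocycleClass _) (Subtype.ext (ContinuousMap.ext fun _ ↦ rfl))

variable (W : WeierstrassCurve K) [W.IsElliptic] (p : ℕ) [Fact p.Prime]

omit [W.IsElliptic] [Fact p.Prime] in
/-- The change of level `E[p^N] ↪ E[p^M]` carries `Ш²(K, E[p^N])` into `Ш²(K, E[p^M])` (naturality of localisation at EVERY
place; X11b's `map_torsionInclusion_mem_shaTwo` is the totally complex case). [folklore] -/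
theorem map_torsionInclusion_mem_shaTwo' {N M : ℕ} (h : N ≤ M)
    {z : galoisCohomology (W.torsionGaloisModule ((p ^ N : ℕ) : ℤ)) 2}
    (hz : z ∈ shaTwo (W.torsionGaloisModule ((p ^ N : ℕ) : ℤ))) :
    galoisCohomology.map (W.torsionInclusion
      (Summit.BirchSwinnertonDyer.Rank1Residual.X11b.WeakLeopoldt.pow_dvd_pow_cast p h)) 2 z ∈
        shaTwo (W.torsionGaloisModule ((p ^ M : ℕ) : ℤ)) := by
  rw [mem_shaTwo_iff] at hz ⊢
  rintro (w | v)
  · rw [localization_inl_map_two, hz (Sum.inl w)]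
    exact map_zero _
  · rw [Summit.BirchSwinnertonDyer.Rank1Residual.X11b.WeakLeopoldt.localization_inr_map_two, hz (Sum.inr v)]
    exact map_zero _

/-- **Every class of `Ш²(K, E[p^∞])` is the image of a class of `Ш²(K, E[p^M])` for some `M ≥ 1`**: lift to a level
`N` (X11b `exists_map_two_primaryInclusion_eq_of_global`); off a finite set `S` of finite places the lift is locally zero
(X11b `eventually_localization_two_torsion_eq_zero`, Milne I Lemma 4.8); at `v ∈ S` and at the finitely many infinite
places the localisation of the lift dies in `E[p^∞]`, hence at some finite level (§2); push to the maximum of these levels.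
[cite: MilneADT2006, Ch. I §4, Lemma 4.8] [cite: Harari2020, Lemma 17.8] -/
theorem exists_mem_shaTwo_map_primaryInclusion_eq
    (Z : galoisCohomology (LocBridge.primaryGaloisModule W p) 2) (hZ : Z ∈ shaTwo (LocBridge.primaryGaloisModule W p)) :
    ∃ M : ℕ, M ≠ 0 ∧ ∃ z : galoisCohomology (W.torsionGaloisModule ((p ^ M : ℕ) : ℤ)) 2,
      z ∈ shaTwo (W.torsionGaloisModule ((p ^ M : ℕ) : ℤ)) ∧ galoisCohomology.map (primaryInclusion W p M) 2 z = Z := by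
  obtain ⟨N, hN0, z, rfl⟩ :=
    Summit.BirchSwinnertonDyer.Rank1Residual.X11b.WeakLeopoldt.exists_map_two_primaryInclusion_eq_of_global W p Z
  rw [mem_shaTwo_iff] at hZ
  -- levels at which the localisations of `z` die
  have hfin : ∀ v : HeightOneSpectrum (𝓞 K), ∃ (Mv : ℕ) (h : N ≤ Mv),
      galoisCohomology.map ((W.torsionInclusion
        (Summit.BirchSwinnertonDyer.Rank1Residual.X11b.WeakLeopoldt.pow_dvd_pow_cast p h)).restrictField
          (v.adicCompletion K)) 2
        (galoisCohomology.localization (W.torsionGaloisModule ((p ^ N : ℕ) : ℤ)) (Sum.inr v) 2 z) = 0 := fun v ↦ by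
    refine exists_le_map_torsionInclusion_two_eq_zero W p (v.adicCompletion K) _ ?_
    rw [← Summit.BirchSwinnertonDyer.Rank1Residual.X11b.WeakLeopoldt.localization_inr_map_two]
    exact hZ (Sum.inr v)
  have hinf : ∀ w : InfinitePlace K, ∃ (Mw : ℕ) (h : N ≤ Mw),
      galoisCohomology.map ((W.torsionInclusion
        (Summit.BirchSwinnertonDyer.Rank1Residual.X11b.WeakLeopoldt.pow_dvd_pow_cast p h)).restrictField
          w.Completion) 2
        (galoisCohomology.localization (W.torsionGaloisModule ((p ^ N : ℕ) : ℤ)) (Sum.inl w) 2 z) = 0 := fun w ↦ by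
    refine exists_le_map_torsionInclusion_two_eq_zero W p w.Completion _ ?_
    rw [← localization_inl_map_two]
    exact hZ (Sum.inl w)
  choose Mv hMv hMv0 using hfin
  choose Mw hMw hMw0 using hinf
  -- the finite exceptional set and the common level
  have hS := Summit.BirchSwinnertonDyer.Rank1Residual.X11b.H2Support.eventually_localization_two_torsion_eq_zero W p N z
  rw [Filter.eventually_cofinite] at hS
  set M : ℕ := N + hS.toFinset.sup Mv + Finset.univ.sup Mw with hMdef
  have hNM : N ≤ M := by omega
  have hvM : ∀ v ∈ hS.toFinset, Mv v ≤ M := fun v hv ↦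
    (Finset.le_sup (f := Mv) hv).trans (by omega)
  have hwM : ∀ w, Mw w ≤ M := fun w ↦ (Finset.le_sup (f := Mw) (Finset.mem_univ w)).trans (by omega)
  refine ⟨M, by omega, galoisCohomology.map (W.torsionInclusion
    (Summit.BirchSwinnertonDyer.Rank1Residual.X11b.WeakLeopoldt.pow_dvd_pow_cast p hNM)) 2 z, ?_,
    Summit.BirchSwinnertonDyer.Rank1Residual.X11b.WeakLeopoldt.map_primaryInclusion_map_torsionInclusion W p hNM z⟩
  rw [mem_shaTwo_iff]
  rintro (w | v)
  · rw [localization_inl_map_two]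
    exact map_torsionInclusion_two_eq_zero_mono W p w.Completion (hMw w) (hwM w) _ (hMw0 w)
  · rw [Summit.BirchSwinnertonDyer.Rank1Residual.X11b.WeakLeopoldt.localization_inr_map_two]
    by_cases hv : galoisCohomology.localization (W.torsionGaloisModule ((p ^ N : ℕ) : ℤ)) (Sum.inr v) 2 z = 0
    · rw [hv]; exact map_zero _
    · have hvS : v ∈ hS.toFinset := by simpa using hv
      exact map_torsionInclusion_two_eq_zero_mono W p (v.adicCompletion K) (hMv v) (hvM v hvS) _ (hMv0 v)

/-- **`Ш²(K, E[p^∞])` is finite, of order at most `#Sel_{p^∞}(E/K)`**, when `Sel_{p^∞}(E/K)` is finite and `E[p^∞]^{Γ_K} = 0`,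
granted `poitouTate_sha_tateDual K`: every finite set of classes of `Ш²(K, E[p^∞])` comes from ONE `Ш²(K, E[p^M])` (the above +
monotonicity), whose order is `≤ #Sel_{p^∞}(E/K)` (§1). [cite: Harari2020, Thm. 17.13 (b)] [cite: JetchevSkinnerWan2017, Lemma 3.3.3 (arXiv:1512.06894 p. 12)] -/
theorem finite_shaTwo_primary_and_natCard_le (hPT : poitouTate_sha_tateDual K) [Finite (W.selmerGroupPInfty p)]
    (hΓ : ∀ Q : W.geomPrimaryTorsion p, (∀ σ : absoluteGaloisGroup K, LocBridge.primaryGaloisModule W p σ Q = Q) → Q = 0) :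
    Finite (shaTwo (LocBridge.primaryGaloisModule W p)) ∧
      Nat.card (shaTwo (LocBridge.primaryGaloisModule W p)) ≤ Nat.card (W.selmerGroupPInfty p) := by
  -- every finite set of classes of `Ш²(K, E[p^∞])` has at most `#Sel` elements
  have key : ∀ s : Finset (galoisCohomology (LocBridge.primaryGaloisModule W p) 2),
      (∀ Z ∈ s, Z ∈ shaTwo (LocBridge.primaryGaloisModule W p)) → s.card ≤ Nat.card (W.selmerGroupPInfty p) := by
    intro s hs
    choose M hM0 z hzsha hz using fun Z : shaTwo (LocBridge.primaryGaloisModule W p) ↦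
      exists_mem_shaTwo_map_primaryInclusion_eq W p Z.1 Z.2
    set L : ℕ := (s.attach.image fun Z ↦ M ⟨Z.1, hs Z.1 Z.2⟩).sup id + 1 with hL
    have hML : ∀ (Z) (hZ : Z ∈ s), M ⟨Z, hs Z hZ⟩ ≤ L := fun Z hZ ↦ by
      have : M ⟨Z, hs Z hZ⟩ ∈ s.attach.image fun Z ↦ M ⟨Z.1, hs Z.1 Z.2⟩ :=
        Finset.mem_image.mpr ⟨⟨Z, hZ⟩, Finset.mem_attach _ _, rfl⟩
      exact (Finset.le_sup (f := id) this).trans (Nat.le_succ _)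
    obtain ⟨hfinL, hcardL⟩ := natCard_shaTwo_torsion_le_selmerGroupPInfty W p hPT (Nat.succ_ne_zero _) hΓ (k := L)
    haveI := hfinL
    haveI := Fintype.ofFinite (shaTwo (W.torsionGaloisModule ((p ^ L : ℕ) : ℤ)))
    let g : shaTwo (W.torsionGaloisModule ((p ^ L : ℕ) : ℤ)) → galoisCohomology (LocBridge.primaryGaloisModule W p) 2 :=
      fun y ↦ galoisCohomology.map (primaryInclusion W p L) 2 y
    have hsub : s ⊆ Finset.univ.image g := by
      intro Z hZ
      rw [Finset.mem_image]
      refine ⟨⟨galoisCohomology.map (W.torsionInclusion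
          (Summit.BirchSwinnertonDyer.Rank1Residual.X11b.WeakLeopoldt.pow_dvd_pow_cast p (hML Z hZ))) 2 (z ⟨Z, hs Z hZ⟩),
        map_torsionInclusion_mem_shaTwo' W p (hML Z hZ) (hzsha ⟨Z, hs Z hZ⟩)⟩, Finset.mem_univ _, ?_⟩
      change galoisCohomology.map (primaryInclusion W p L) 2
        (galoisCohomology.map (W.torsionInclusion
          (Summit.BirchSwinnertonDyer.Rank1Residual.X11b.WeakLeopoldt.pow_dvd_pow_cast p (hML Z hZ))) 2 (z ⟨Z, hs Z hZ⟩)) = Z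
      rw [Summit.BirchSwinnertonDyer.Rank1Residual.X11b.WeakLeopoldt.map_primaryInclusion_map_torsionInclusion W p (hML Z hZ),
        hz]
    calc s.card ≤ (Finset.univ.image g).card := Finset.card_le_card hsub
      _ ≤ Finset.univ.card := Finset.card_image_le
      _ = Nat.card (shaTwo (W.torsionGaloisModule ((p ^ L : ℕ) : ℤ))) := by
          rw [Finset.card_univ, Nat.card_eq_fintype_card]
      _ ≤ Nat.card (W.selmerGroupPInfty p) := hcardL
  -- finiteness
  have hfin : Finite (shaTwo (LocBridge.primaryGaloisModule W p)) := by
    by_contra hinf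
    rw [not_finite_iff_infinite] at hinf
    obtain ⟨t, -, ht⟩ := (Set.infinite_univ (α := shaTwo (LocBridge.primaryGaloisModule W p))).exists_subset_card_eq
      (Nat.card (W.selmerGroupPInfty p) + 1)
    have h := key (t.map (Function.Embedding.subtype _)) (fun Z hZ ↦ by
      obtain ⟨Z', -, rfl⟩ := Finset.mem_map.mp hZ
      exact Z'.2)
    rw [Finset.card_map] at h
    omega
  refine ⟨hfin, ?_⟩
  haveI := Fintype.ofFinite (shaTwo (LocBridge.primaryGaloisModule W p))
  have h := key ((Finset.univ : Finset (shaTwo (LocBridge.primaryGaloisModule W p))).map (Function.Embedding.subtype _))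
    (fun Z hZ ↦ by
      obtain ⟨Z', -, rfl⟩ := Finset.mem_map.mp hZ
      exact Z'.2)
  rwa [Finset.card_map, Finset.card_univ, ← Nat.card_eq_fintype_card] at h

end Global

end Summit.BirchSwinnertonDyer.BirchSwinnertonDyer.Theorems.SignedEC.ShaTwo

end
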